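import Summits.CriticalPhenomena.PercolationContinuityZ3.Theorems.PercNearOneGluingNoHeavyLowerTailKnQuestion8CoefficientwiseAttachmentResidue
import Summits.CriticalPhenomena.PercolationContinuityZ3.Theorems.PercNearOneGluingNoHeavyLowerTailKnQuestion8CoefficientwiseIslandFactorisation
import HarnessLib

/-!
# The HARD CORE: the canonical attached set `A*` never meets an island, so the `A*`-involution acts on PRIME colourings (prim-lf-2 gen 36,
      memo §0(iv), §2.5)

Support file (`--supports stmt-CriticalPhenomena-4575`, closed), prover `prim-lf-2` (gen 36).  No definitions, no named facts,
      no sorries; standard axioms.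
Memo `prim-lf-2/CW-RESIDUE-gen36.md` §0(iv), §2.5, §2.8.

Setting as in …AttachmentResidue (canonical selector `A*(s) = ⋂₀{W | x ∉ W, lobe_w(s) ⊆ W, W attached}`, any map `𝓐` with `𝓐 s
      = A*(s)`) and …IslandMax
(ISLANDS: `Y ∋ x`, `Y ∌ w`, boundary vertices red- and blue-reachable from `x` inside `Y`); wall SET `Z`; vertex finset `Vs`.
* `Coefficientwise.lobe_disjoint_island` — the lobe of `w` never meets an island (lobe vertices are non-core, island boundaries are core);
* `Coefficientwise.aStar_disjoint_island` — **`A*(s) ∩ Y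
      = ∅` for every island `Y`** (minimality: `A*(s) \ Y` is again attached and contains the lobe — a
  neighbour in `A* ∩ Y` of a vertex outside `Y` is a boundary vertex of `Y`, doubly reachable inside `Y`, whose edges avoid `A* \ Y`);
* `Coefficientwise.island_aStarFlip_iff` — hence the `A*`-flip `s ↦ s ∆ I(A*(s))` changes no edge inside an island and preserves every island (both directions,
  using `aStar_flip_eq`);
* `Coefficientwise.primeSum_eq_hardCoreSum` — **HARD-CORE IDENTITY**: the point-row sum over the PRIME wall colourings (no island `≠ {x}` inside `Vs`) equals its
  restriction to the prime colourings with `u ∈ A*(s)`; the prime `A*`-free colourings pair off (`Finset.sum_involution`,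
        flip formulas of …AttachmentFlipWeak).
With …IslandFactorisation (`pointRow_eq_sum_islands`): the point row is a nonnegative combination of HARD-CORE sums of quotients — the hard core (prime ∧
`u ∈ A*`) is exactly what a proof of the point row has to sign (census memo §3.3: nonempty ⇒ sum ≥ 1; with a crossing ⇒ #conc ≥ #cross + 2, n ≤ 7).
[cite: KozmaNitzan2024, Questions 8–9 (§5.5 p. 36) (context: the Question-8 pocket covariance programme)]
-/

namespace Summit.CriticalPhenomena.PercolationContinuityZ3.Theorems

open Finset Literature.Probability.Percolation
open scoped symmDiff

namespace Coefficientwise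

variable {ι V : Type*}

open Classical in
/-- The lobe of `w` does not meet an island `Y ∌ w` (`s
      ⊆ E`): lobe vertices are non-core, a lobe path entering `Y` would do so at a boundary vertex of `Y`,
which is core. [cite: KozmaNitzan2024, §5.5 (context only)] -/
theorem lobe_disjoint_island (ends : ι → Sym2 V) (E s : Finset ι) (x w : V) (Y : Finset V) (hwY : w ∉ Y)
    (hY : (∀ t ∈ Y, t ≠ x → (∃ i ∈ E, ∃ t', ends i = s(t, t') ∧ t' ∉ Y) →
          t ∈ openCluster (ends '' (↑(s.filter (fun i => ∀ y ∈ ends i, y ∈ Y)) : Set ι)) x ∧ t ∈ openCluster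
                (ends '' (↑((E \ s).filter (fun i => ∀ y ∈ ends i, y ∈ Y)) : Set ι)) x)) :
    ∀ v, v ∈ openCluster (ends '' (↑(E.filter (fun i => ∀ y ∈ ends i,
          (y ∈ openCluster (ends '' (↑s : Set ι)) x ∨ y ∈ openCluster (ends '' (↑(E \ s) : Set ι)) x) ∧
          ¬ (y ∈ openCluster (ends '' (↑s : Set ι)) x ∧ y ∈ openCluster (ends '' (↑(E \ s) : Set ι)) x))) : Set ι)) w → v ∉ Y := by
  have key : openCluster (ends '' (↑(E.filter (fun i => ∀ y ∈ ends i,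
          (y ∈ openCluster (ends '' (↑s : Set ι)) x ∨ y ∈ openCluster (ends '' (↑(E \ s) : Set ι)) x) ∧
          ¬ (y ∈ openCluster (ends '' (↑s : Set ι)) x ∧ y ∈ openCluster (ends '' (↑(E \ s) : Set ι)) x))) : Set ι)) w ⊆ {v | v ∉ Y} := by
    refine openCluster_subset_of_closed ends _ w (show w ∈ {v : V | v ∉ Y} from hwY) ?_
    intro i hi a b he ha hbY
    rw [Finset.mem_filter] at hi
    have hb := hi.2 b (by rw [he]; exact Sym2.mem_mk_right a b)
    -- `b ∈ Y` has the neighbour `a ∉ Y`: `b` is a boundary vertex (it is not `x`, being non-core) hence core — contradiction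
    have hbx : b ≠ x := by
      rintro rfl
      exact hb.2 ⟨mem_openCluster_self _ _, mem_openCluster_self _ _⟩
    have h := hY b hbY hbx ⟨i, hi.1, a, by rw [he, Sym2.eq_swap], ha⟩
    exact hb.2 ⟨openCluster_image_mono ends (Finset.filter_subset _ _) x h.1,
      openCluster_image_mono ends (Finset.filter_subset _ _) x h.2⟩
  intro v hv
  exact key hv

open Classical in
/-- **`A*` avoids islands.**  For `s ⊆ E`, `w ≠ x`, and an island `Y` (`x ∈ Y`, `w ∉ Y`): `A*(s) ∩ Y
      = ∅`. [cite: KozmaNitzan2024, §5.5 (context only)] -/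
theorem aStar_disjoint_island (ends : ι → Sym2 V) (E : Finset ι) (x w : V) (hwx : w ≠ x) (𝓐 : Finset ι → Set V)
    (h𝓐 : ∀ s : Finset ι, 𝓐 s = ⋂₀ {W : Set V | x ∉ W ∧
        openCluster (ends '' (↑(E.filter (fun i => ∀ y ∈ ends i,
          (y ∈ openCluster (ends '' (↑s : Set ι)) x ∨ y ∈ openCluster (ends '' (↑(E \ s) : Set ι)) x) ∧
          ¬ (y ∈ openCluster (ends '' (↑s : Set ι)) x ∧ y ∈ openCluster (ends '' (↑(E \ s) : Set ι)) x))) : Set ι)) w ⊆ W ∧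
        (∀ v ∈ W, ∀ i ∈ E, ∀ v', ends i = s(v, v') →
          (v' ∈ openCluster (ends '' (↑s : Set ι)) x ∨ v' ∈ openCluster (ends '' (↑(E \ s) : Set ι)) x) → v' ≠ x → v' ∉ W →
            v' ∈ openCluster (ends '' (↑(s \ E.filter (fun i => ∃ v, v ∈ W ∧ v ∈ ends i)) : Set ι)) x ∧
            v' ∈ openCluster (ends '' (↑((E \ s) \ E.filter (fun i => ∃ v, v ∈ W ∧ v ∈ ends i)) : Set ι)) x)})
    (s : Finset ι) (Y : Finset V) (hwY : w ∉ Y)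
    (hY : (∀ t ∈ Y, t ≠ x → (∃ i ∈ E, ∃ t', ends i = s(t, t') ∧ t' ∉ Y) →
          t ∈ openCluster (ends '' (↑(s.filter (fun i => ∀ y ∈ ends i, y ∈ Y)) : Set ι)) x ∧ t ∈ openCluster
                (ends '' (↑((E \ s).filter (fun i => ∀ y ∈ ends i, y ∈ Y)) : Set ι)) x)) :
    ∀ v ∈ Y, v ∉ 𝓐 s := by
  have hxA := not_mem_aStar ends E x w hwx 𝓐 h𝓐 s
  have hAtt := attached_aStar ends E x w 𝓐 h𝓐 s
  have hlobe := lobe_subset_aStar ends E x w 𝓐 h𝓐 s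
  have hlobeY := lobe_disjoint_island ends E s x w Y hwY hY
  -- `A' = A*(s) \ Y` belongs to the defining family
  set A' : Set V := {v | v ∈ 𝓐 s ∧ v ∉ Y} with hA'
  have hI : E.filter (fun i => ∃ v, v ∈ A' ∧ v ∈ ends i) ⊆ E.filter (fun i => ∃ v, v ∈ 𝓐 s ∧ v ∈ ends i) := by
    intro i hi
    rw [Finset.mem_filter] at hi ⊢
    obtain ⟨hiE, v, hv, hvi⟩ := hi
    exact ⟨hiE, v, hv.1, hvi⟩
  have monoR : openCluster (ends '' (↑(s \ E.filter (fun i => ∃ v, v ∈ 𝓐 s ∧ v ∈ ends i)) : Set ι)) x ⊆ openCluster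
        (ends '' (↑(s \ E.filter (fun i => ∃ v, v ∈ A' ∧ v ∈ ends i)) : Set ι)) x :=
    openCluster_image_mono ends (Finset.sdiff_subset_sdiff (subset_refl _) hI) x
  have monoB : openCluster (ends '' (↑((E \ s) \ E.filter (fun i => ∃ v, v ∈ 𝓐 s ∧ v ∈ ends i)) : Set ι)) x ⊆ openCluster
        (ends '' (↑((E \ s) \ E.filter (fun i => ∃ v, v ∈ A' ∧ v ∈ ends i)) : Set ι)) x :=
    openCluster_image_mono ends (Finset.sdiff_subset_sdiff (subset_refl _) hI) x
  -- edges inside `Y` avoid `A'`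
  have insideR : s.filter (fun i => ∀ y ∈ ends i, y ∈ Y) ⊆ s \ E.filter (fun i => ∃ v, v ∈ A' ∧ v ∈ ends i) := by
    intro i hi
    rw [Finset.mem_filter] at hi
    rw [Finset.mem_sdiff, Finset.mem_filter]
    refine ⟨hi.1, fun h => ?_⟩
    obtain ⟨-, v, hv, hvi⟩ := h
    exact hv.2 (hi.2 v hvi)
  have insideB : (E \ s).filter (fun i => ∀ y ∈ ends i, y ∈ Y) ⊆ (E \ s) \ E.filter (fun i => ∃ v, v ∈ A' ∧ v ∈ ends i) := by
    intro i hi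
    rw [Finset.mem_filter] at hi
    rw [Finset.mem_sdiff, Finset.mem_filter]
    refine ⟨hi.1, fun h => ?_⟩
    obtain ⟨-, v, hv, hvi⟩ := h
    exact hv.2 (hi.2 v hvi)
  have hmem : A' ∈ {W : Set V | x ∉ W ∧
        openCluster (ends '' (↑(E.filter (fun i => ∀ y ∈ ends i,
          (y ∈ openCluster (ends '' (↑s : Set ι)) x ∨ y ∈ openCluster (ends '' (↑(E \ s) : Set ι)) x) ∧
          ¬ (y ∈ openCluster (ends '' (↑s : Set ι)) x ∧ y ∈ openCluster (ends '' (↑(E \ s) : Set ι)) x))) : Set ι)) w ⊆ W ∧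
        (∀ v ∈ W, ∀ i ∈ E, ∀ v', ends i = s(v, v') →
          (v' ∈ openCluster (ends '' (↑s : Set ι)) x ∨ v' ∈ openCluster (ends '' (↑(E \ s) : Set ι)) x) → v' ≠ x → v' ∉ W →
            v' ∈ openCluster (ends '' (↑(s \ E.filter (fun i => ∃ v, v ∈ W ∧ v ∈ ends i)) : Set ι)) x ∧
            v' ∈ openCluster (ends '' (↑((E \ s) \ E.filter (fun i => ∃ v, v ∈ W ∧ v ∈ ends i)) : Set ι)) x)} := by
    refine ⟨fun h => hxA h.1, fun v hv => ⟨hlobe hv, hlobeY v hv⟩, ?_⟩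
    intro v hv i hi v' he hU hne hnA'
    by_cases hv'A : v' ∈ 𝓐 s
    · -- `v' ∈ A* ∩ Y`, adjacent to `v ∉ Y`: a boundary vertex of the island
      have hv'Y : v' ∈ Y := by
        by_contra h
        exact hnA' ⟨hv'A, h⟩
      have h := hY v' hv'Y hne ⟨i, hi, v, by rw [he, Sym2.eq_swap], hv.2⟩
      exact ⟨openCluster_image_mono ends insideR x h.1, openCluster_image_mono ends insideB x h.2⟩
    · have h := hAtt v hv.1 i hi v' he hU hne hv'A
      exact ⟨monoR h.1, monoB h.2⟩
  intro v hvY hvA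
  have hsub : 𝓐 s ⊆ A' := by
    have h := Set.sInter_subset_of_mem hmem
    rw [← h𝓐] at h
    exact h
  exact (hsub hvA).2 hvY

open Classical in
/-- **The `A*`-flip preserves islands** (`s
      ⊆ E`, `w ≠ x`): for `Y ∋ x`, `Y ∌ w`, `Y` is an island of `s ∆ I(A*(s))` iff it is an island of `s` — the flip changes
no edge inside an island. [cite: KozmaNitzan2024, §5.5 (context only)] -/
theorem island_aStarFlip_iff (ends : ι → Sym2 V) (E : Finset ι) (x w : V) (hwx : w ≠ x) (𝓐 : Finset ι → Set V)
    (h𝓐 : ∀ s : Finset ι, 𝓐 s = ⋂₀ {W : Set V | x ∉ W ∧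
        openCluster (ends '' (↑(E.filter (fun i => ∀ y ∈ ends i,
          (y ∈ openCluster (ends '' (↑s : Set ι)) x ∨ y ∈ openCluster (ends '' (↑(E \ s) : Set ι)) x) ∧
          ¬ (y ∈ openCluster (ends '' (↑s : Set ι)) x ∧ y ∈ openCluster (ends '' (↑(E \ s) : Set ι)) x))) : Set ι)) w ⊆ W ∧
        (∀ v ∈ W, ∀ i ∈ E, ∀ v', ends i = s(v, v') →
          (v' ∈ openCluster (ends '' (↑s : Set ι)) x ∨ v' ∈ openCluster (ends '' (↑(E \ s) : Set ι)) x) → v' ≠ x → v' ∉ W →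
            v' ∈ openCluster (ends '' (↑(s \ E.filter (fun i => ∃ v, v ∈ W ∧ v ∈ ends i)) : Set ι)) x ∧
            v' ∈ openCluster (ends '' (↑((E \ s) \ E.filter (fun i => ∃ v, v ∈ W ∧ v ∈ ends i)) : Set ι)) x)})
    (s : Finset ι) (hs : s ⊆ E) (Y : Finset V) (hwY : w ∉ Y) :
    (∀ t ∈ Y, t ≠ x → (∃ i ∈ E, ∃ t', ends i = s(t, t') ∧ t' ∉ Y) →
          t ∈ openCluster (ends '' (↑((s ∆ E.filter (fun i => ∃ v, v ∈ 𝓐 s ∧ v ∈ ends i)).filter (fun i => ∀ y ∈ ends i, y ∈ Y)) : Set ι)) x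
                ∧ t ∈ openCluster (ends '' (↑((E \ (s ∆ E.filter (fun i => ∃ v, v ∈ 𝓐 s
                ∧ v ∈ ends i))).filter (fun i => ∀ y ∈ ends i, y ∈ Y)) : Set ι)) x) ↔
    (∀ t ∈ Y, t ≠ x → (∃ i ∈ E, ∃ t', ends i = s(t, t') ∧ t' ∉ Y) →
          t ∈ openCluster (ends '' (↑(s.filter (fun i => ∀ y ∈ ends i, y ∈ Y)) : Set ι)) x ∧ t ∈ openCluster
                (ends '' (↑((E \ s).filter (fun i => ∀ y ∈ ends i, y ∈ Y)) : Set ι)) x) := by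
  have hinv := aStar_flip_eq ends E x w hwx 𝓐 h𝓐 s hs
  -- if `A* ∩ Y = ∅`, the flip changes nothing inside `Y`
  have same : ∀ t : Finset ι, (∀ v ∈ Y, v ∉ 𝓐 s) →
      (t ∆ E.filter (fun i => ∃ v, v ∈ 𝓐 s ∧ v ∈ ends i)).filter (fun i => ∀ y ∈ ends i, y ∈ Y) = t.filter (fun i => ∀ y ∈ ends i, y ∈ Y) := by
    intro t hdis
    ext i
    rw [Finset.mem_filter, Finset.mem_filter, Finset.mem_symmDiff]
    constructor
    · rintro ⟨⟨hit, -⟩ | ⟨hiI, -⟩, hin⟩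
      · exact ⟨hit, hin⟩
      · obtain ⟨-, v, hv, hvi⟩ := Finset.mem_filter.mp hiI
        exact absurd hv (hdis v (hin v hvi))
    · rintro ⟨hit, hin⟩
      refine ⟨Or.inl ⟨hit, fun hiI => ?_⟩, hin⟩
      obtain ⟨-, v, hv, hvi⟩ := Finset.mem_filter.mp hiI
      exact hdis v (hin v hvi) hv
  have csame : (∀ v ∈ Y, v ∉ 𝓐 s) →
      (E \ (s ∆ E.filter (fun i => ∃ v, v ∈ 𝓐 s ∧ v ∈ ends i))).filter (fun i => ∀ y ∈ ends i, y ∈ Y)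
            = (E \ s).filter (fun i => ∀ y ∈ ends i, y ∈ Y) := by
    intro hdis
    ext i
    rw [Finset.mem_filter, Finset.mem_filter, Finset.mem_sdiff, Finset.mem_sdiff, Finset.mem_symmDiff]
    constructor
    · rintro ⟨⟨hiE, hn⟩, hin⟩
      refine ⟨⟨hiE, fun his => ?_⟩, hin⟩
      by_cases hiI : i ∈ E.filter (fun i => ∃ v, v ∈ 𝓐 s ∧ v ∈ ends i)
      · obtain ⟨-, v, hv, hvi⟩ := Finset.mem_filter.mp hiI
        exact hdis v (hin v hvi) hv
      · exact hn (Or.inl ⟨his, hiI⟩)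
    · rintro ⟨⟨hiE, hnis⟩, hin⟩
      refine ⟨⟨hiE, ?_⟩, hin⟩
      rintro (⟨his, -⟩ | ⟨hiI, -⟩)
      · exact hnis his
      · obtain ⟨-, v, hv, hvi⟩ := Finset.mem_filter.mp hiI
        exact hdis v (hin v hvi) hv
  constructor
  · intro hY'
    -- `A*(s') = A*(s)` avoids `Y` (island of `s'`)
    have hdis' := aStar_disjoint_island ends E x w hwx 𝓐 h𝓐 (s ∆ E.filter (fun i => ∃ v, v ∈ 𝓐 s ∧ v ∈ ends i)) Y hwY hY'
    rw [hinv] at hdis'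
    rw [same s hdis', csame hdis'] at hY'
    exact hY'
  · intro hY
    have hdis := aStar_disjoint_island ends E x w hwx 𝓐 h𝓐 s Y hwY hY
    rw [same s hdis, csame hdis]
    exact hY

open Classical in
/-- **HARD-CORE IDENTITY.**  Over the PRIME wall colourings (no island `Y
      ⊆ Vs` other than `{x}`), the point-row sum equals its restriction to the colourings with
`u ∈ A*(s)`: the prime `A*`-free colourings cancel in pairs under the `A*`-flip. [cite: KozmaNitzan2024, Questions 8–9 (§5.5 p. 36) (context)] -/
theorem primeSum_eq_hardCoreSum (ends : ι → Sym2 V) (E : Finset ι) (Vs : Finset V) (x u w : V) (Z : Set V) (hwx : w ≠ x) (𝓐 : Finset ι → Set V)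
    (h𝓐 : ∀ s : Finset ι, 𝓐 s = ⋂₀ {W : Set V | x ∉ W ∧
        openCluster (ends '' (↑(E.filter (fun i => ∀ y ∈ ends i,
          (y ∈ openCluster (ends '' (↑s : Set ι)) x ∨ y ∈ openCluster (ends '' (↑(E \ s) : Set ι)) x) ∧
          ¬ (y ∈ openCluster (ends '' (↑s : Set ι)) x ∧ y ∈ openCluster (ends '' (↑(E \ s) : Set ι)) x))) : Set ι)) w ⊆ W ∧
        (∀ v ∈ W, ∀ i ∈ E, ∀ v', ends i = s(v, v') →
          (v' ∈ openCluster (ends '' (↑s : Set ι)) x ∨ v' ∈ openCluster (ends '' (↑(E \ s) : Set ι)) x) → v' ≠ x → v' ∉ W →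
            v' ∈ openCluster (ends '' (↑(s \ E.filter (fun i => ∃ v, v ∈ W ∧ v ∈ ends i)) : Set ι)) x ∧
            v' ∈ openCluster (ends '' (↑((E \ s) \ E.filter (fun i => ∃ v, v ∈ W ∧ v ∈ ends i)) : Set ι)) x)}) :
    ∑ s ∈ E.powerset.filter (fun s : Finset ι =>
        (∀ z ∈ Z, z ∉ openCluster (ends '' (↑s : Set ι)) x ∧ z ∉ openCluster (ends '' (↑(E \ s) : Set ι)) x) ∧
        (∀ Y : Finset V, Y ⊆ Vs → x ∈ Y → w ∉ Y → Y ≠ {x} →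
          ¬ (∀ t ∈ Y, t ≠ x → (∃ i ∈ E, ∃ t', ends i = s(t, t') ∧ t' ∉ Y) →
          t ∈ openCluster (ends '' (↑(s.filter (fun i => ∀ y ∈ ends i, y ∈ Y)) : Set ι)) x ∧ t ∈ openCluster
                (ends '' (↑((E \ s).filter (fun i => ∀ y ∈ ends i, y ∈ Y)) : Set ι)) x))),
      ((if u ∈ openCluster (ends '' (↑s : Set ι)) x then (1 : ℝ) else 0) - (if u ∈ openCluster (ends '' (↑(E \ s) : Set ι)) x then (1 : ℝ) else 0)) *
        ((if w ∈ openCluster (ends '' (↑s : Set ι)) x then (1 : ℝ) else 0) - (if w ∈ openCluster (ends '' (↑(E \ s) : Set ι)) x then (1 : ℝ) else 0))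
    = ∑ s ∈ E.powerset.filter (fun s : Finset ι =>
        ((∀ z ∈ Z, z ∉ openCluster (ends '' (↑s : Set ι)) x ∧ z ∉ openCluster (ends '' (↑(E \ s) : Set ι)) x) ∧
         (∀ Y : Finset V, Y ⊆ Vs → x ∈ Y → w ∉ Y → Y ≠ {x} →
          ¬ (∀ t ∈ Y, t ≠ x → (∃ i ∈ E, ∃ t', ends i = s(t, t') ∧ t' ∉ Y) →
          t ∈ openCluster (ends '' (↑(s.filter (fun i => ∀ y ∈ ends i, y ∈ Y)) : Set ι)) x ∧ t ∈ openCluster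
                (ends '' (↑((E \ s).filter (fun i => ∀ y ∈ ends i, y ∈ Y)) : Set ι)) x))) ∧ u ∈ 𝓐 s),
      ((if u ∈ openCluster (ends '' (↑s : Set ι)) x then (1 : ℝ) else 0) - (if u ∈ openCluster (ends '' (↑(E \ s) : Set ι)) x then (1 : ℝ) else 0)) *
        ((if w ∈ openCluster (ends '' (↑s : Set ι)) x then (1 : ℝ) else 0) - (if w ∈ openCluster (ends '' (↑(E \ s) : Set ι)) x then (1 : ℝ)
              else 0)) := by
  set S₀ : Finset (Finset ι) := E.powerset.filter (fun s : Finset ι =>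
      (∀ z ∈ Z, z ∉ openCluster (ends '' (↑s : Set ι)) x ∧ z ∉ openCluster (ends '' (↑(E \ s) : Set ι)) x) ∧
      (∀ Y : Finset V, Y ⊆ Vs → x ∈ Y → w ∉ Y → Y ≠ {x} →
          ¬ (∀ t ∈ Y, t ≠ x → (∃ i ∈ E, ∃ t', ends i = s(t, t') ∧ t' ∉ Y) →
          t ∈ openCluster (ends '' (↑(s.filter (fun i => ∀ y ∈ ends i, y ∈ Y)) : Set ι)) x ∧ t ∈ openCluster
                (ends '' (↑((E \ s).filter (fun i => ∀ y ∈ ends i, y ∈ Y)) : Set ι)) x))) with hS₀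
  set f : Finset ι → ℝ := fun s : Finset ι =>
      ((if u ∈ openCluster (ends '' (↑s : Set ι)) x then (1 : ℝ) else 0) - (if u ∈ openCluster (ends '' (↑(E \ s) : Set ι)) x then (1 : ℝ) else 0)) *
        ((if w ∈ openCluster (ends '' (↑s : Set ι)) x then (1 : ℝ) else 0) - (if w ∈ openCluster (ends '' (↑(E \ s) : Set ι)) x then (1 : ℝ)
              else 0)) with hf
  have hsplit : ∑ s ∈ S₀, f s = ∑ s ∈ S₀.filter (fun s => u ∈ 𝓐 s), f s + ∑ s ∈ S₀.filter (fun s => ¬ u ∈ 𝓐 s), f s :=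
    (Finset.sum_filter_add_sum_filter_not S₀ (fun s => u ∈ 𝓐 s) f).symm
  have hzero : ∑ s ∈ S₀.filter (fun s => ¬ u ∈ 𝓐 s), f s = 0 := by
    refine Finset.sum_involution (fun s _ => s ∆ E.filter (fun i => ∃ v, v ∈ 𝓐 s ∧ v ∈ ends i)) ?_ ?_ ?_ ?_
    · -- the summand changes sign
      intro s hs
      rw [Finset.mem_filter, hS₀, Finset.mem_filter, Finset.mem_powerset] at hs
      obtain ⟨⟨hsE, -, -⟩, huA⟩ := hs
      have hxA := not_mem_aStar ends E x w hwx 𝓐 h𝓐 s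
      have hwA := mem_aStar ends E x w 𝓐 h𝓐 s
      have hAtt := attached_aStar ends E x w 𝓐 h𝓐 s
      have red := mem_openCluster_flip_iff_attachment ends (E₀ := E) (s := s) (z := x) hsE (𝓐 s) hxA hAtt
      have blue := mem_openCluster_sdiff_flip_iff_attachment ends (E₀ := E) (s := s) (z := x) hsE (𝓐 s) hxA hAtt
      have hu1 : (if u ∈ openCluster (ends '' (↑(s ∆ E.filter (fun i => ∃ v, v ∈ 𝓐 s ∧ v ∈ ends i)) : Set ι)) x then (1 : ℝ) else 0)
            = (if u ∈ openCluster (ends '' (↑s : Set ι)) x then (1 : ℝ) else 0) := by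
        by_cases h : u ∈ openCluster (ends '' (↑s : Set ι)) x
        · rw [if_pos h, if_pos ((red u).mpr (Or.inr (Or.inl ⟨h, huA⟩)))]
        · have h' : u ∉ openCluster (ends '' (↑(s ∆ E.filter (fun i => ∃ v, v ∈ 𝓐 s ∧ v ∈ ends i)) : Set ι)) x := by
            intro hh
            rcases (red u).mp hh with rfl | ⟨hA, -⟩ | ⟨hW, -⟩
            · exact h (mem_openCluster_self _ _)
            · exact h hA
            · exact huA hW
          rw [if_neg h, if_neg h']
      have hu2 : (if u ∈ openCluster (ends '' (↑(E \ (s ∆ E.filter (fun i => ∃ v, v ∈ 𝓐 s ∧ v ∈ ends i))) : Set ι)) x then (1 : ℝ) else 0)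
            = (if u ∈ openCluster (ends '' (↑(E \ s) : Set ι)) x then (1 : ℝ) else 0) := by
        by_cases h : u ∈ openCluster (ends '' (↑(E \ s) : Set ι)) x
        · rw [if_pos h, if_pos ((blue u).mpr (Or.inr (Or.inl ⟨h, huA⟩)))]
        · have h' : u ∉ openCluster (ends '' (↑(E \ (s ∆ E.filter (fun i => ∃ v, v ∈ 𝓐 s ∧ v ∈ ends i))) : Set ι)) x := by
            intro hh
            rcases (blue u).mp hh with rfl | ⟨hB, -⟩ | ⟨hW, -⟩
            · exact h (mem_openCluster_self _ _)
            · exact h hB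
            · exact huA hW
          rw [if_neg h, if_neg h']
      have hw1 : (if w ∈ openCluster (ends '' (↑(s ∆ E.filter (fun i => ∃ v, v ∈ 𝓐 s ∧ v ∈ ends i)) : Set ι)) x then (1 : ℝ) else 0)
            = (if w ∈ openCluster (ends '' (↑(E \ s) : Set ι)) x then (1 : ℝ) else 0) := by
        by_cases h : w ∈ openCluster (ends '' (↑(E \ s) : Set ι)) x
        · rw [if_pos h, if_pos ((red w).mpr (Or.inr (Or.inr ⟨hwA, h⟩)))]
        · have h' : w ∉ openCluster (ends '' (↑(s ∆ E.filter (fun i => ∃ v, v ∈ 𝓐 s ∧ v ∈ ends i)) : Set ι)) x := by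
            intro hh
            rcases (red w).mp hh with hwx' | ⟨-, hW⟩ | ⟨-, hB⟩
            · exact hwx hwx'
            · exact hW hwA
            · exact h hB
          rw [if_neg h, if_neg h']
      have hw2 : (if w ∈ openCluster (ends '' (↑(E \ (s ∆ E.filter (fun i => ∃ v, v ∈ 𝓐 s ∧ v ∈ ends i))) : Set ι)) x then (1 : ℝ) else 0)
            = (if w ∈ openCluster (ends '' (↑s : Set ι)) x then (1 : ℝ) else 0) := by
        by_cases h : w ∈ openCluster (ends '' (↑s : Set ι)) x
        · rw [if_pos h, if_pos ((blue w).mpr (Or.inr (Or.inr ⟨hwA, h⟩)))]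
        · have h' : w ∉ openCluster (ends '' (↑(E \ (s ∆ E.filter (fun i => ∃ v, v ∈ 𝓐 s ∧ v ∈ ends i))) : Set ι)) x := by
            intro hh
            rcases (blue w).mp hh with hwx' | ⟨-, hW⟩ | ⟨-, hA⟩
            · exact hwx hwx'
            · exact hW hwA
            · exact h hA
          rw [if_neg h, if_neg h']
      simp only [hf]
      rw [hu1, hu2, hw1, hw2]
      ring
    · -- non-fixed when the summand is nonzero
      intro s hs hfs heq
      rw [Finset.mem_filter, hS₀, Finset.mem_filter, Finset.mem_powerset] at hs
      obtain ⟨⟨hsE, -, -⟩, -⟩ := hs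
      have hwA := mem_aStar ends E x w 𝓐 h𝓐 s
      have hI0 : E.filter (fun i => ∃ v, v ∈ 𝓐 s ∧ v ∈ ends i) = ∅ := by
        have h := symmDiff_eq_left.mp heq
        simpa using h
      have noI : ∀ i ∈ E, w ∉ ends i := by
        intro i hi hwi
        have : i ∈ E.filter (fun i => ∃ v, v ∈ 𝓐 s ∧ v ∈ ends i) := Finset.mem_filter.mpr ⟨hi, w, hwA, hwi⟩
        rw [hI0] at this
        exact absurd this (Finset.notMem_empty i)
      have hw1 : w ∉ openCluster (ends '' (↑s : Set ι)) x := by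
        intro hw
        obtain ⟨e, he, hwe⟩ := exists_edge_of_mem_openCluster ends hw hwx
        exact noI e (hsE he) hwe
      have hw2 : w ∉ openCluster (ends '' (↑(E \ s) : Set ι)) x := by
        intro hw
        obtain ⟨e, he, hwe⟩ := exists_edge_of_mem_openCluster ends hw hwx
        exact noI e (Finset.sdiff_subset he) hwe
      apply hfs
      simp only [hf]
      rw [if_neg hw1, if_neg hw2, sub_zero, mul_zero]
    · -- the partner is again prime, wall, `A*`-free
      intro s hs
      rw [Finset.mem_filter, hS₀, Finset.mem_filter, Finset.mem_powerset] at hs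
      obtain ⟨⟨hsE, hwall, hprime⟩, huA⟩ := hs
      have hxA := not_mem_aStar ends E x w hwx 𝓐 h𝓐 s
      have hAtt := attached_aStar ends E x w 𝓐 h𝓐 s
      have hinv := aStar_flip_eq ends E x w hwx 𝓐 h𝓐 s hsE
      have hU := union_flip_eq_attachment ends hsE (𝓐 s) hxA hAtt
      rw [Finset.mem_filter, hS₀, Finset.mem_filter, Finset.mem_powerset]
      refine ⟨⟨?_, ?_, ?_⟩, ?_⟩
      · intro i hi
        rcases Finset.mem_symmDiff.mp hi with ⟨h, -⟩ | ⟨h, -⟩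
        · exact hsE h
        · exact (Finset.mem_filter.mp h).1
      · intro z hz
        have hzU : z ∉ openCluster (ends '' (↑s : Set ι)) x ∪ openCluster (ends '' (↑(E \ s) : Set ι)) x := by
          intro h
          rcases h with h | h
          · exact (hwall z hz).1 h
          · exact (hwall z hz).2 h
        rw [← hU] at hzU
        exact ⟨fun h => hzU (Or.inl h), fun h => hzU (Or.inr h)⟩
      · intro Y hYV hxY hwY hne hI
        exact hprime Y hYV hxY hwY hne ((island_aStarFlip_iff ends E x w hwx 𝓐 h𝓐 s hsE Y hwY).mp hI)
      · rw [hinv]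
        exact huA
    · intro s hs
      rw [Finset.mem_filter, hS₀, Finset.mem_filter, Finset.mem_powerset] at hs
      obtain ⟨⟨hsE, -, -⟩, -⟩ := hs
      have hinv := aStar_flip_eq ends E x w hwx 𝓐 h𝓐 s hsE
      show (s ∆ E.filter (fun i => ∃ v, v ∈ 𝓐 s ∧ v ∈ ends i)) ∆ E.filter (fun i => ∃ v, v ∈ 𝓐 (s ∆ E.filter (fun i => ∃ v, v ∈ 𝓐 s ∧ v ∈ ends i))
            ∧ v ∈ ends i) = s
      rw [hinv]
      exact symmDiff_symmDiff_cancel_right _ s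
  have h1 : S₀.filter (fun s => u ∈ 𝓐 s) = E.powerset.filter (fun s : Finset ι =>
      ((∀ z ∈ Z, z ∉ openCluster (ends '' (↑s : Set ι)) x ∧ z ∉ openCluster (ends '' (↑(E \ s) : Set ι)) x) ∧
       (∀ Y : Finset V, Y ⊆ Vs → x ∈ Y → w ∉ Y → Y ≠ {x} →
          ¬ (∀ t ∈ Y, t ≠ x → (∃ i ∈ E, ∃ t', ends i = s(t, t') ∧ t' ∉ Y) →
          t ∈ openCluster (ends '' (↑(s.filter (fun i => ∀ y ∈ ends i, y ∈ Y)) : Set ι)) x ∧ t ∈ openCluster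
                (ends '' (↑((E \ s).filter (fun i => ∀ y ∈ ends i, y ∈ Y)) : Set ι)) x))) ∧ u ∈ 𝓐 s) := by
    rw [hS₀, Finset.filter_filter]
  rw [hsplit, hzero, add_zero, h1]

end Coefficientwise

end Summit.CriticalPhenomena.PercolationContinuityZ3.Theorems
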